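import Summits.AtomisticToContinuum.HydrodynamicLimit.Theses.CollisionIsometryCLT
import Summits.AtomisticToContinuum.HydrodynamicLimit.Theses.StiffCollisionalRelaxation
import Literature.Analysis.FunctionSpaces.TorusMollifier

/-!
# Line `commutator-matched-bootstrap` for crux `AprioriBounds` (stmt-AtomisticToContinuum-9519)

Route `CollisionIsometryCLT` (decl shared verbatim with `StiffCollisionalRelaxation.AprioriBounds`; the skeleton closes
BOTH copies by name: `AprioriBounds_of`, `AprioriBounds_of_stiff`), sub-problem `HydrodynamicLimit`.  Skeleton line (crux-plan, round 1): seven registered stubs `stub_*`, the sorry-free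
statement-level composition `repairedDilute_of_statements` (stub STATEMENTS ⇒ the repaired crux
`AprioriBoundsRepairedDilute`), and the skeleton theorem `AprioriBounds_of` concluding the crux decl BY NAME
(no other `sorry`).

## Idea (card `commutator-matched-bootstrap`, triage r1-1/2/3: pass ×3)

A-priori cell bounds are OUTPUTS.  Compare the block fields `Ū_N = (ρ̄, m̄, Ē)` of the gas — read through the
tree's standard mollifier `ψ_N = Torus.kernel (κ (N+1)^{-γ})` (even, `C^∞`, unit mass; the line's OWN reference
kernel, triage r1-2) — not with the classical solution `U_cl` but with `Ũ := ψ_N ∗ U_cl`, and keep the EXACT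
filtering commutator `comm_j := ψ_N ∗ F_j(U_cl) − F_j(ψ_N ∗ U_cl)` (`= ½m₂h²F″[∇U,∇U] + O(h⁴)`) on the
comparison side of the tested balance laws (`matchedResidual`).  Then the resolved-gradient part of the
kinetic defect (the refuters' floor `ρ̄m₂h²(∇u∇uᵀ)°`, `Θ(N^{-2γ}) ≫ N^{-3γ}` if unmatched, triage r1-2 §A)
cancels instead of forcing, and the Dafermos relative-entropy Gronwall inequality for
`∫h(Ū_N | Ũ)` runs at precision `o(h³)` (`stub_matchedGronwall`, deterministic, constant `K` uniform in the
kernel radius) — provided the entropy side is booked with the DECONVOLVED functional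
`S_N = ∫η_σ(Ū) + ½m₂∫Σ_k D²η_σ(Ū)[∂_kŪ,∂_kŪ]` (triage r1-1: the plain block entropy releases the Jensen gap
`±c h²`; `S_N` is the Gibbs rate function of the block profile, and the sign of its quadratic part is what
lets the Gronwall consume a ONE-sided second law).  A violated cell is a LUMP: kernel block fields cannot
vary faster than the kernel allows, so one cell leaving the chamber `{c ≤ ρ̄ ≤ C_R, Ē ≤ E₁, internal ≥ e₀}`
at one instant weighs `≥ κ₀ h³` in `L²` against any Lipschitz comparison field (`FootprintLemma`, raw
counts controlled by the same-scale sup bound through the averaging identity `∫_{B_{3h}}ρ̄ ≥ (N+1)⁻¹#B_{2h}`).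
Stopped-window continuity argument (`stub_stoppedWindow`): up to the first exit time `τ_N` the chamber
hypotheses of the Gronwall hold, the rated inputs (`stub_staticBudget`: `H(0)` and the `S_N` second law at
`(N+1)^{-3γ-β}`; `stub_matchedResidual`: the matched weak residual at `(N+1)^{-3γ-β}` — the HARDEST stub, the
rated/recentred/tested form of FastMomentRelaxation 9522 + CollisionalTransferLocality 9518) give
`sup_{s ≤ τ_N ∧ t}‖Ū − Ũ‖²_{L²} = o(h³)`, the footprint gives `≥ κ₀h³` at `τ_N` — so `P(τ_N ≤ t) → 0`:
two-sided density bounds, an energy cap and a temperature floor at EVERY reference scale, pre-shock, in the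
dilute chamber (`WindowPackage`).  The sandwich lemma (`KernelSandwichLemma`, second half of
`stub_kernelGeometry`) transfers the density bounds to every admissible kernel family (part (ii)); the cap is
the hot-spot envelope the (i)-lines need, and part (i) is imported from the sibling line
`visit-ledger-upscattering` through ONE docking stub `stub_partOne_of_window` (one stopping time for both
halves, triage r1-2 G3 / r1-3 C3).

## What this skeleton concludes, honestly (triage r1-2 G1, r1-3 C0/C1; Disproof §5–§6)

The crux AS TYPED quantifies `∀ t > 0` over all continuous profiles with `σ₀, λ` before `N`; every card on
the board (and the standing disprover) reaches only the PRE-SHOCK, DILUTE-CHAMBER restatement.  This file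
therefore PROVES `repairedDilute_of_statements : stubs ⇒ AprioriBoundsRepairedDilute` — Disproof §6
`AprioriBoundsRepaired` (C′: conditioned on a classical hs-Euler solution with LLN data, `t < T`) PLUS the
chamber clause `2ρ_clσ³ < η₁` that triage r1-3 C1 asks the planner to put into C′ — and isolates the typed
over-reach in ONE declared stub `stub_typedCrux_of_repaired : AprioriBoundsRepairedDilute → AprioriBounds`
(triage r1-3 C0: "every skeleton's last stub is `PreShock → AprioriBounds`, unprovable"; its converse
`repairedDilute_of_typed` is PROVED here, so the stub is exactly the gap and nothing else).  No idea produces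
that stub; its region is the disprover's SUBSTANTIVE THREAT (post-collapse Guderley focusing); it disappears
the moment the planner restates 9519 to C′ (+C1), at which point `repairedDilute_of_statements` IS the line.

Disproof used (`Cruxes/AprioriBounds/Disproof.lean`, cdisprove v3.1, rc 0): tightness `c₁ ≤ 1`, `σ₀ ≤ 1`
(§2–3) — every density floor here is existential and every `σ₀` is a `min` the stubs may shrink; §3d
`aprioriBoundsII_false_without_small_sigma` — the line uses `σ < σ₀` at `stub_stoppedWindow` (dilute chamber
`C_Rσ³ ≤ η₁ ≤ η₀` of HsEntropyUniformlyConvex) and at `stub_matchedResidual`; §4d (`∀λ` false) — `λ` stays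
existential inside `PartI`, produced by the sibling line below `1/(2θ⁺)` with `θ⁺` = this window's cap;
§5/§6 — see above.  Negatives index (12): none instantiated (all statements polynomial-rate, in probability;
no sub-population variance quantifier, no `e^{-cN}` currency for cubic weights).
-/

noncomputable section

open MeasureTheory Filter Set Topology
open scoped ENNReal BigOperators

namespace Summit.AtomisticToContinuum.HydrodynamicLimit.Cruxes.AprioriBounds.CommutatorMatchedBootstrap

open Literature.MathematicalPhysics.KineticTheory Literature.Analysis.FluidPDE
open Literature.Analysis.FunctionSpaces.Torus (kernel reprc partialDeriv timeDeriv)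

/-! ## Vocabulary -/

/-- Conserved state `(ρ, m, E)`. -/
abbrev State : Type := ℝ × V3 × ℝ

/-- Phase space of `N + 1` spheres on `𝕋³`. -/
abbrev Cfg (N : ℕ) : Type := Config (N + 1) (Fin 3) T3

/-- Hard-sphere flows of `N + 1` spheres at reduced density `σ`. -/
abbrev Flow (σ : ℝ) (N : ℕ) : Type :=
  HardSphereFlow (Torus.geometry (Fin 3)) (hsDiameter σ N) (N + 1)

/-- Block density of the configuration `w` through the kernel `φ` centred at `x` (the crux's `ρ̄`). -/
def rhoB {N : ℕ} (φ : T3 → ℝ) (w : Cfg N) (x : T3) : ℝ :=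
  empiricalDensityField w (fun y => φ (y - x))

/-- Block momentum. -/
def momB {N : ℕ} (φ : T3 → ℝ) (w : Cfg N) (x : T3) : V3 :=
  empiricalMomentumField w (fun y => φ (y - x))

/-- Block energy. -/
def enB {N : ℕ} (φ : T3 → ℝ) (w : Cfg N) (x : T3) : ℝ :=
  empiricalEnergyField w (fun y => φ (y - x))

/-- The block state field `Ū = (ρ̄, m̄, Ē)`. -/
def blockState {N : ℕ} (φ : T3 → ℝ) (w : Cfg N) (x : T3) : State :=
  (rhoB φ w x, momB φ w x, enB φ w x)

/-- Reference radius `κ (N+1)^{-γ}`. -/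
def refRadius (γ κ : ℝ) (N : ℕ) : ℝ := κ * ((N : ℝ) + 1) ^ (-γ)

/-- The line's OWN reference kernel: the tree's standard torus mollifier at radius `κ(N+1)^{-γ}` (even,
smooth, unit mass, supported in the ball, `≤ C κ⁻³(N+1)^{3γ}`, gradient `≤ Cκ⁻⁴(N+1)^{4γ}` — itself an
admissible kernel at exponent `γ`; cf. Disproof `admissibleKernelFamilyExists`). -/
def refKernel (γ κ : ℝ) (N : ℕ) : T3 → ℝ := kernel (refRadius γ κ N)

/-- Admissible kernel family at exponent `γ` with constant `C` — VERBATIM the crux's six conjuncts. -/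
def Admissible (γ C : ℝ) (φ : ℕ → T3 → ℝ) : Prop :=
  (∀ N, Literature.Analysis.FunctionSpaces.Torus.IsSmooth (φ N)) ∧ (∀ N y, 0 ≤ φ N y) ∧
    (∀ N, ∫ y, φ N y = 1) ∧
    (∀ (N : ℕ) y, ((N : ℝ) + 1) ^ (-γ) ≤ Torus.euclidDist y 0 → φ N y = 0) ∧
    (∀ (N : ℕ) y, φ N y ≤ C * ((N : ℝ) + 1) ^ (3 * γ)) ∧
    (∀ (N : ℕ) y, ‖Literature.Analysis.FunctionSpaces.Torus.gradient (φ N) y‖ ≤ C * ((N : ℝ) + 1) ^ (4 * γ))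

/-- Part (i) of the crux at `(σ, profiles, Φ, t)` — VERBATIM. -/
def PartI (σ : ℝ) (a₀ θ₀ : T3 → ℝ) (u₀ : T3 → V3) (Φ : (N : ℕ) → Flow σ N) (t : ℝ) : Prop :=
  ∃ lam Cexp : ℝ, 0 < lam ∧ Tendsto (fun N : ℕ => localGibbsLaw σ a₀ u₀ θ₀ N (Φ N)
    {z | Cexp < ∫ s in Icc 0 t, ∫ y, Real.exp (lam * ‖y.2‖ ^ 2) ∂(empiricalMeasure ((Φ N).flow s z))})
    atTop (𝓝 0)

/-- Part (ii) of the crux at `(σ, Φ, t)` along an arbitrary family of laws `P` (VERBATIM body). -/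
def PartIIFor (σ : ℝ) (P : (N : ℕ) → Measure (Cfg N)) (Φ : (N : ℕ) → Flow σ N) (t : ℝ) : Prop :=
  ∀ (γ C : ℝ) (φ : ℕ → T3 → ℝ), 0 < γ → γ ≤ 1 / 15 → Admissible γ C φ →
    ∃ c₁ : ℝ, 0 < c₁ ∧ Tendsto (fun N : ℕ => P N {z | ∃ s ∈ Icc 0 t, ∃ x : T3,
      empiricalDensityField ((Φ N).flow s z) (fun y => φ N (y - x)) < c₁ ∨
        1 < empiricalDensityField ((Φ N).flow s z) (fun y => φ N (y - x)) * σ ^ 3}) atTop (𝓝 0)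

/-- Part (ii) of the crux at `(σ, profiles, Φ, t)` — VERBATIM (the local Gibbs laws). -/
def PartII (σ : ℝ) (a₀ θ₀ : T3 → ℝ) (u₀ : T3 → V3) (Φ : (N : ℕ) → Flow σ N) (t : ℝ) : Prop :=
  PartIIFor σ (fun N => localGibbsLaw σ a₀ u₀ θ₀ N (Φ N)) Φ t

/-- The reference chamber FAILS at configuration `w`: some reference cell (kernel `refKernel γ κ N`) has
density below `c`, density above `C_R`, energy above `E₁`, or internal energy `Ē − |m̄|²/(2ρ̄)` below `e₀`. -/
def RefChamberFails (γ κ c CR E₁ e₀ : ℝ) (N : ℕ) (w : Cfg N) : Prop :=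
  ∃ x : T3, rhoB (refKernel γ κ N) w x < c ∨ CR < rhoB (refKernel γ κ N) w x ∨
    E₁ < enB (refKernel γ κ N) w x ∨
    enB (refKernel γ κ N) w x - ‖momB (refKernel γ κ N) w x‖ ^ 2 / (2 * rhoB (refKernel γ κ N) w x) < e₀

/-- "The window covers `[0, t]` with probability `→ 1`": the probability that the reference chamber fails at
some `s ≤ t` tends to `0` along the laws `P`. -/
def WindowFailureVanishes (σ : ℝ) (P : (N : ℕ) → Measure (Cfg N)) (Φ : (N : ℕ) → Flow σ N)
    (t γ κ c CR E₁ e₀ : ℝ) : Prop :=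
  Tendsto (fun N : ℕ => P N {z | ∃ s ∈ Icc 0 t, RefChamberFails γ κ c CR E₁ e₀ N ((Φ N).flow s z)})
    atTop (𝓝 0)

/-- The convex entropy `η_σ(ρ, m, E) = −ρ s` of the hard-sphere gas — VERBATIM the route's `ησ`
(RelEntropyStability 9520, SecondLawInProbability 9521, HsEntropyUniformlyConvex 9525). -/
def etaσ (σ : ℝ) (U : State) : ℝ :=
  -(U.1 * (3 / 2 * Real.log (2 / 3 * (U.2.2 / U.1 - ‖U.2.1‖ ^ 2 / (2 * U.1 ^ 2))) - Real.log U.1 -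
    hsExcessFreeEnergy (U.1 * σ ^ 3)))

/-- The hard-sphere Euler fluxes `F_j(U)` in conserved variables — VERBATIM the route's `Fl` (9520). -/
def fluxHS (σ : ℝ) (j : Fin 3) (U : State) : State :=
  ((U.2.1 j,
    (U.2.1 j / U.1) • U.2.1 +
      hsPressure σ U.1 (2 / 3 * (U.2.2 / U.1 - ‖U.2.1‖ ^ 2 / (2 * U.1 ^ 2))) • EuclideanSpace.single j (1 : ℝ),
    (U.2.2 + hsPressure σ U.1 (2 / 3 * (U.2.2 / U.1 - ‖U.2.1‖ ^ 2 / (2 * U.1 ^ 2)))) * U.2.1 j / U.1) : State)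

/-- The conserved state field `U_cl = (ρ, ρu, E)` of a classical solution. -/
def classicalState (ρ θ : ℝ → T3 → ℝ) (u : ℝ → T3 → V3) (s : ℝ) (x : T3) : State :=
  (ρ s x, ρ s x • u s x, totalEnergyDensity (ρ s x) (u s x) (θ s x))

/-- Smoothing of a state field by the kernel `φ` with the SAME orientation as the block fields:
`(φ ⋆ G)(x) = ∫ φ(y − x) G(y) dy` (so that `blockState φ w = φ ⋆ (empirical measure of w)`). -/
def smoothState (φ : T3 → ℝ) (G : T3 → State) (x : T3) : State :=
  ∫ y, φ (y - x) • G y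

/-- The comparison field `Ũ = φ ⋆ U_cl` (filtered classical solution). -/
def filtered (φ : T3 → ℝ) (ρ θ : ℝ → T3 → ℝ) (u : ℝ → T3 → V3) (s : ℝ) (x : T3) : State :=
  smoothState φ (classicalState ρ θ u s) x

/-- THE MATCHED COMMUTATOR, exact: `comm_j = φ ⋆ F_j(U_cl) − F_j(φ ⋆ U_cl)` (Leonard/Germano filtering
identity; `= ½ m₂(φ) Σ_k ∂²F_j[∂_kU_cl, ∂_kU_cl] + O(h⁴)` for an even kernel).  `Ũ` solves
`∂_s Ũ + Σ_j ∂_j (F_j(Ũ) + comm_j) = 0` EXACTLY. -/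
def comm (σ : ℝ) (φ : T3 → ℝ) (ρ θ : ℝ → T3 → ℝ) (u : ℝ → T3 → V3) (s : ℝ) (x : T3) (j : Fin 3) :
    State :=
  smoothState φ (fun y => fluxHS σ j (classicalState ρ θ u s y)) x - fluxHS σ j (filtered φ ρ θ u s x)

/-- Relative entropy `∫ h(V | W) = ∫ [η(V) − η(W) − Dη(W)(V − W)]` (Dafermos (5.2.1)). -/
def relEnt (σ : ℝ) (V W : T3 → State) : ℝ :=
  ∫ x, (etaσ σ (V x) - etaσ σ (W x) - (fderiv ℝ (etaσ σ) (W x)) (V x - W x))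

/-- Per-coordinate second moment `m₂(φ) = ∫ φ(y) y₀²` of a kernel (`= ⅓∫|y|²φ` for the radial reference
kernel; `≍ h²`). -/
def secondMoment (φ : T3 → ℝ) : ℝ :=
  ∫ y, φ y * (reprc y 0) ^ 2

/-- THE DECONVOLVED (LD-sharp) block entropy `S(V) = ∫ [η_σ(V) + ½ m₂ Σ_k D²η_σ(V)[∂_kV, ∂_kV]]`
(triage r1-1 §A(3): the Gibbs rate function of a `φ`-smoothed block profile, modulo affine terms and `O(h⁴)`;
its quadratic part is `≥ 0` wherever `η_σ` is convex — the sign the Gronwall uses). -/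
def correctedEntropy (σ : ℝ) (φ : T3 → ℝ) (V : T3 → State) : ℝ :=
  ∫ x, (etaσ σ (V x) + secondMoment φ / 2 *
    ∑ k : Fin 3, (fderiv ℝ (fderiv ℝ (etaσ σ)) (V x)) (partialDeriv k V x) (partialDeriv k V x))

/-- THE MATCHED WEAK RESIDUAL of a field `U` on `[0, τ]`: the tested balance-law defect against the
entropy multipliers `Λ̃ = Dη_σ(Ũ)` of the FILTERED classical solution, with the flux RECENTRED by the
commutator — `[∫Λ̃·U]₀^τ − ∫₀^τ∫(∂_sΛ̃·U + Σ_j ∂_jΛ̃·(F_j(U) + comm_j))`.  For `U = Ū_N` this is, by the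
exact microscopic balance laws, `∫₀^τ∫∇Λ̃ : [(kinetic defect D, q-terms − comm) + (collisional transfer −
p_c-terms)]`: the recentred tested kinetic defect (K1′ = 9522♮) plus the tested collisional residual (K2 =
9518). -/
def matchedResidual (σ : ℝ) (φ : T3 → ℝ) (ρ θ : ℝ → T3 → ℝ) (u : ℝ → T3 → V3) (U : ℝ → T3 → State)
    (τ : ℝ) : ℝ :=
  (∫ x, (fderiv ℝ (etaσ σ) (filtered φ ρ θ u τ x)) (U τ x)) -
    (∫ x, (fderiv ℝ (etaσ σ) (filtered φ ρ θ u 0 x)) (U 0 x)) -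
    ∫ s in Icc 0 τ, ∫ x,
      ((timeDeriv (fun s' x' => fderiv ℝ (etaσ σ) (filtered φ ρ θ u s' x')) s x) (U s x) +
        ∑ j : Fin 3, (partialDeriv j (fun x' => fderiv ℝ (etaσ σ) (filtered φ ρ θ u s x')) x)
          (fluxHS σ j (U s x) + comm σ φ ρ θ u s x j))

/-- Open convexity region around the window's closed chamber (factor-2 margins). -/
def openChamber (σ η₀ c E₁ e₀ : ℝ) : Set State :=
  {U | c / 2 < U.1 ∧ U.1 * σ ^ 3 < η₀ ∧ U.2.2 < 2 * E₁ ∧ e₀ / 2 < U.2.2 - ‖U.2.1‖ ^ 2 / (2 * U.1)}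

/-- The window's closed chamber: `c ≤ ρ`, `ρσ³ ≤ η₀/2`, `E ≤ E₁`, internal energy `≥ e₀`. -/
def InClosedChamber (σ η₀ c E₁ e₀ : ℝ) (U : State) : Prop :=
  c ≤ U.1 ∧ 2 * U.1 * σ ^ 3 ≤ η₀ ∧ U.2.2 ≤ E₁ ∧ e₀ ≤ U.2.2 - ‖U.2.1‖ ^ 2 / (2 * U.1)

/-! ## The statements of the line -/

/-- FOOTPRINT LEMMA (deterministic, `N`-uniform; first half of `stub_kernelGeometry`).  For a sup-closeness
threshold `ε`, a-priori bounds `C_R, E₁` and a Lipschitz constant `L` there are `κ₀, r₀ > 0` such that for every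
radius `r ≤ r₀`, every configuration `w` whose reference block fields (kernel `Torus.kernel r`) obey
`ρ̄ ≤ 2C_R`, `Ē ≤ 2E₁` everywhere (what survives at a first-exit time), and every `L`-Lipschitz comparison
field `W`: if ONE point has `‖Ū(x₀) − W(x₀)‖ ≥ ε`, then `‖Ū − W‖²_{L²(𝕋³)} ≥ κ₀ r³`.  Mechanism: every
component of `Ū` has gradient `≤ ‖∇ψ_r‖_∞ (N+1)⁻¹ Σ_{B_r(x)} (1, |vᵢ|, |vᵢ|²/2)`, and the averaging identity
`(N+1)⁻¹ Σ_{i ∈ B_{2r}(x₀)} wᵢ ≤ vol(B_{3r}) · sup_x F̄_r(x)` (unit mass, support in `B_r`) turns the SAME-SCALE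
sup bounds into raw count / momentum / energy bounds on `B_{2r}(x₀)`, so `|∇Ū| ≤ C(C_R, E₁)/r` near `x₀` and
the deficit `≥ ε/2` persists on a ball of radius `≍ ε r`; `κ₀ ≍ ε⁵/C³` (triage r1-1 §A(4), r1-3:
`κ ≍ σ⁹c₁⁵/C³` with `C_R ≍ σ⁻³`, `ε ≍ c₁`).  Chamber exits are special cases (`W = Ũ` sits in the inner
chamber with factor-2 margins, so leaving the chamber forces `‖Ū − Ũ‖ ≥ ε(c, C_R, E₁, e₀)` somewhere). -/
def FootprintLemma : Prop :=
  ∀ (ε CR E₁ L : ℝ), 0 < ε → 0 < CR → 0 < E₁ → 0 ≤ L →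
    ∃ κ₀ r₀ : ℝ, 0 < κ₀ ∧ 0 < r₀ ∧ ∀ r : ℝ, 0 < r → r ≤ r₀ →
      ∀ (N : ℕ) (w : Cfg N) (W : T3 → State),
        (∀ x y : T3, ‖W x - W y‖ ≤ L * Torus.euclidDist x y) →
        (∀ x, rhoB (kernel r) w x ≤ 2 * CR ∧ enB (kernel r) w x ≤ 2 * E₁) →
        (∃ x₀ : T3, ε ≤ ‖blockState (kernel r) w x₀ - W x₀‖) →
        κ₀ * r ^ 3 ≤ ∫ x, ‖blockState (kernel r) w x - W x‖ ^ 2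

/-- KERNEL SANDWICH (deterministic core + monotonicity of measures; second half of `stub_kernelGeometry`;
triage r1-2 sharpening).  There is an absolute `A > 0` such that, along ANY laws `P`, two-sided reference
density bounds `c ≤ ρ̄_ψ ≤ C_R` with `C_Rσ³ ≤ A` holding on `[0,t]` w.h.p. at EVERY reference scale
`κ(N+1)^{-γ}` imply part (ii) for every admissible family `φ` at every `γ`: an admissible `φ` (mass 1 in
`B_h`, `sup ≤ Ch⁻³`, `|∇φ| ≤ Ch⁻⁴`) is `≥ ½ sup φ` on a ball of radius `≍ h/C` (lower transfer from scale
`≍ h/C`), and `ρ̄_φ ≤ (1 + O(εC)) · sup(sub-ball averages at scale εh)` (upper transfer, `ε ≍ 1/C`). -/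
def KernelSandwichLemma : Prop :=
  ∃ A : ℝ, 0 < A ∧ ∀ σ : ℝ, 0 < σ →
    ∀ (P : (N : ℕ) → Measure (Cfg N)) (Φ : (N : ℕ) → Flow σ N) (t : ℝ),
      (∀ γ κ : ℝ, 0 < γ → γ ≤ 1 / 15 → 0 < κ → κ ≤ 1 / 4 →
        ∃ c CR E₁ e₀ : ℝ, 0 < c ∧ CR * σ ^ 3 ≤ A ∧ WindowFailureVanishes σ P Φ t γ κ c CR E₁ e₀) →
      PartIIFor σ P Φ t

/-- MATCHED RELATIVE-ENTROPY GRONWALL (deterministic PDE statement; the quantitative form of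
RelEntropyStability 9520 with comparison field `Ũ = ψ_r ⋆ U_cl` and the commutator kept exactly).  Under
smoothness of the excess free energy on `(0, η₀)` and `m`-uniform convexity of `η_σ` on the open chamber,
for a classical solution in the inner chamber on `[0, t₁]` there are `K, r₀, ε₀` such that FOR EVERY radius
`r ≤ r₀` (uniformity in `r` is the whole point) every smooth-in-`x`, bounded, measurable field `U` with
values in the closed chamber and within sup-distance `ε₀` of `Ũ` on `[0, t₁]`, initial relative entropy
`≤ δ₀`, DECONVOLVED second law `S(U(τ)) ≤ S(U(0)) + δ₂`, and matched weak residual `≤ δ_w`, satisfies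
`sup_{τ ≤ t₁} ‖U(τ) − Ũ(τ)‖²_{L²} ≤ K (δ₀ + δ₂ + δ_w + r⁴)`.  Bookkeeping (Dafermos 5.2 + two identities):
`H(τ) − H(0) = [∫η(U)]₀^τ − [∫η(Ũ)]₀^τ − ∫₀^τ∫{∇Λ̃ : F(U|Ũ) + (residual rate) − (D²η(Ũ) div comm)·(U − Ũ)}`,
`[∫η(Ũ)]₀^τ = −[½m₂∫D²η(Ũ)[∇Ũ]²]₀^τ + O(r⁴)` (classical entropy conservation + Jensen-gap expansion), and
`[∫η(U)]₀^τ ≤ δ₂ + X(U(0)) − X(U(τ))`, `X(V) := ½m₂∫Σ_kD²η(V)[∂_kV,∂_kV]`, with the second-order lower bound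
`X(U) ≥ X(Ũ) + DX(Ũ)[e] − O(r²)‖e‖²₂` (`e := U − Ũ`): the principal quadratic part `½m₂∫D²η(Ũ)[∂e,∂e] ≥
½m₂m‖∂e‖²` ABSORBS the cross term `m₂∫(D²η(U) − D²η(Ũ))[∂Ũ,∂e]` (Young) and the cubic term
`½m₂∫(D²η(U) − D²η(Ũ))[∂e,∂e]` (this is where the sup-closeness hypothesis `‖e‖_∞ ≤ ε₀` with `ε₀ ≍ m/‖D³η‖`
is used); `DX(Ũ)[e] = O(r²‖e‖₁)` by parts.  No inverse inequality and no bound on `∇U` are needed (triage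
r1-2/r1-3 flags answered). -/
def MatchedGronwallLemma : Prop :=
  ∀ (σ η₀ c E₁ e₀ m : ℝ), 0 < σ → 0 < η₀ → 0 < c → 0 < E₁ → 0 < e₀ → 0 < m →
    (∀ n : ℕ, ContDiffOn ℝ n hsExcessFreeEnergy (Set.Ioo 0 η₀)) →
    ConvexOn ℝ (openChamber σ η₀ c E₁ e₀)
      (fun U : State => etaσ σ U - m * (U.1 ^ 2 + ‖U.2.1‖ ^ 2 + U.2.2 ^ 2)) →
    ∀ (T : ℝ) (ρ θ : ℝ → T3 → ℝ) (u : ℝ → T3 → V3), IsHardSphereEulerSolution σ T ρ u θ →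
    ∀ t₁ ∈ Ico 0 T,
      (∀ s ∈ Icc 0 t₁, ∀ x, 2 * c ≤ ρ s x ∧ 4 * ρ s x * σ ^ 3 ≤ η₀ ∧
        2 * totalEnergyDensity (ρ s x) (u s x) (θ s x) ≤ E₁ ∧ 4 * e₀ ≤ 3 * ρ s x * θ s x) →
      ∃ K r₀ ε₀ : ℝ, 0 < K ∧ 0 < r₀ ∧ 0 < ε₀ ∧ ∀ r : ℝ, 0 < r → r ≤ r₀ →
        ∀ (U : ℝ → T3 → State) (δ₀ δ₂ δw : ℝ), 0 ≤ δ₀ → 0 ≤ δ₂ →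
          Measurable (Function.uncurry U) → (∃ B : ℝ, ∀ s x, ‖U s x‖ ≤ B) →
          (∀ s, Literature.Analysis.FunctionSpaces.Torus.IsSmooth (U s)) →
          (∀ s ∈ Icc 0 t₁, ∀ x, InClosedChamber σ η₀ c E₁ e₀ (U s x)) →
          (∀ s ∈ Icc 0 t₁, ∀ x, ‖U s x - filtered (kernel r) ρ θ u s x‖ ≤ ε₀) →
          relEnt σ (U 0) (filtered (kernel r) ρ θ u 0) ≤ δ₀ →
          (∀ τ ∈ Icc 0 t₁,
            correctedEntropy σ (kernel r) (U τ) ≤ correctedEntropy σ (kernel r) (U 0) + δ₂) →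
          (∀ τ ∈ Icc 0 t₁, |matchedResidual σ (kernel r) ρ θ u U τ| ≤ δw) →
          ∀ τ ∈ Icc 0 t₁,
            ∫ x, ‖U τ x - filtered (kernel r) ρ θ u τ x‖ ^ 2 ≤ K * (δ₀ + δ₂ + δw + r ^ 4)

/-- STATICS OF THE EQUATION OF STATE (the two facts `MatchedGronwallLemma` is conditioned on): the excess
free energy is `C^∞` on some `(0, η₀)` (virial analyticity by the cluster expansion — Ruelle1969 Ch. 4,
LebowitzPenrose1964; implied by `HsEosLowDensity`, stmt-0768 of routes BoxDissipativeWeakStrong /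
ImplosionDichotomy, and the standing hypothesis of the Literature file `HardSphereEulerLocalTheory`), AND
`η_σ` is `m`-uniformly convex on every open chamber of this line (exactly HsEntropyUniformlyConvex, stmt-9525
of StiffCollisionalRelaxation — dropped from CollisionIsometryCLT in its rev 9 — restricted to
`openChamber σ η₀ c E₁ e₀ ⊆ {c/2 < ρ, ρσ³ < η₀, |m|² < 2ρE, E < 2E₁}`: the internal-energy floor forces
`|m|² < 2ρE`).  9525 gives only `C²`; the `O(r⁴)` commutator expansions need `C⁵`. -/
def EosStatics : Prop :=
  ∃ η₀ : ℝ, 0 < η₀ ∧ (∀ n : ℕ, ContDiffOn ℝ n hsExcessFreeEnergy (Set.Ioo 0 η₀)) ∧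
    ∀ (σ c E₁ e₀ : ℝ), 0 < σ → 0 < c → 0 < E₁ → 0 < e₀ → ∃ m : ℝ, 0 < m ∧
      ConvexOn ℝ (openChamber σ η₀ c E₁ e₀)
        (fun U : State => etaσ σ U - m * (U.1 ^ 2 + ‖U.2.1‖ ^ 2 + U.2.2 ^ 2))

/-- STATIC BUDGET AT RATE `(N+1)^{-3γ-β}` (probabilistic statics + Liouville; the rated forms of
MesoscopicLLN 9524 and of the second law 9521 for the DECONVOLVED functional, plus the statics of the
equation of state `EosStatics` — one toolkit: the low-density cluster expansion).  For small `σ` there is a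
continuous positive LLN density profile `ρ₀` (identified through `TendstoHydroFieldsAt` at `t = 0`) such that
for every reference scale and every window: (a) the initial relative entropy of the reference block fields
against the smoothed LLN profile is `≤ (N+1)^{-3γ-β}` w.h.p. (CLT level `N^{3γ-1}κ⁻³` + bias `N^{-2/3}`;
needs `γ < 1/6`), and (b) ON THE WINDOW the deconvolved block entropy never exceeds its initial value by more
than `(N+1)^{-3γ-β}` (Hölder transfer `dP_τ/dG = (dP₀/dG)∘Φ_{-τ}` against the refined static LD upper bound
for `ψ`-smoothed block profiles under the invariant Gibbs law, rate `e^{-cN^{1-6γ-2β}}`, union over a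
polynomial time grid; the affine part of the rate function pairs with conserved totals; margin `N^{γ-1/3}` —
thin, triage r1-2 §A). -/
def StaticBudgetLemma : Prop :=
  EosStatics ∧
  ∀ (a₀ θ₀ : T3 → ℝ) (u₀ : T3 → V3), Continuous a₀ → Continuous θ₀ → Continuous u₀ →
    (∀ x, 0 < a₀ x) → (∀ x, 0 < θ₀ x) →
    ∃ σ₀ : ℝ, 0 < σ₀ ∧ ∀ σ : ℝ, 0 < σ → σ < σ₀ →
      ∃ ρ₀ : T3 → ℝ, Continuous ρ₀ ∧ (∀ x, 0 < ρ₀ x) ∧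
      ∀ Φ : (N : ℕ) → Flow σ N,
        TendstoHydroFieldsAt (fun N => localGibbsLaw σ a₀ u₀ θ₀ N (Φ N)) Φ
          (fun _ => ρ₀) (fun _ => u₀) (fun _ => θ₀) 0 ∧
        ∀ (γ κ t c CR E₁ e₀ : ℝ), 0 < γ → γ ≤ 1 / 15 → 0 < κ → κ ≤ 1 / 4 → 0 < t →
          0 < c → CR * σ ^ 3 ≤ 1 → 0 < e₀ →
          ∃ β : ℝ, 0 < β ∧
            Tendsto (fun N : ℕ => localGibbsLaw σ a₀ u₀ θ₀ N (Φ N)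
              {z | ((N : ℝ) + 1) ^ (-(3 * γ + β)) <
                relEnt σ (blockState (refKernel γ κ N) ((Φ N).flow 0 z))
                  (smoothState (refKernel γ κ N)
                    (fun x => (ρ₀ x, ρ₀ x • u₀ x, totalEnergyDensity (ρ₀ x) (u₀ x) (θ₀ x))))})
              atTop (𝓝 0) ∧
            Tendsto (fun N : ℕ => localGibbsLaw σ a₀ u₀ θ₀ N (Φ N)
              {z | ∃ τ ∈ Icc 0 t, (∀ s ∈ Icc 0 τ, ¬ RefChamberFails γ κ c CR E₁ e₀ N ((Φ N).flow s z)) ∧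
                correctedEntropy σ (refKernel γ κ N) (blockState (refKernel γ κ N) ((Φ N).flow 0 z)) +
                    ((N : ℝ) + 1) ^ (-(3 * γ + β)) <
                  correctedEntropy σ (refKernel γ κ N) (blockState (refKernel γ κ N) ((Φ N).flow τ z))})
              atTop (𝓝 0)

/-- MATCHED RESIDUAL AT RATE `(N+1)^{-3γ-β}` ON THE WINDOW (probabilistic dynamics; the HARDEST stub — the
rated, recentred, tested, chamber-conditional form of FastMomentRelaxation 9522 (the route's TARGET) +
CollisionalTransferLocality 9518 that the line demands; triage r1-2 "the line's real first stub", r1-3).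
Pre-shock, with LLN data, for every reference scale and chamber constants with `C_Rσ³ ≤ 1`: w.h.p. the
matched weak residual of the reference block fields stays below `(N+1)^{-3γ-β}` at every `τ ≤ t` up to which
the reference chamber held.  Exponent table at `γ = 1/15` (both triage seats re-derived it): Knudsen /
Navier–Stokes correction `N^{-1/3}` ✓ (iff `γ < 1/9`), tested-statistic fluctuation `N^{-1/2}` ✓, CLT level
`N^{3γ-1}` ✓, matched commutator remainder `h⁴` ✓, UNMATCHED resolved stress `h² = N^{-2/15}` ✗ — matching
is load-bearing. -/
def MatchedResidualLemma : Prop :=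
  ∀ (a₀ θ₀ : T3 → ℝ) (u₀ : T3 → V3), Continuous a₀ → Continuous θ₀ → Continuous u₀ →
    (∀ x, 0 < a₀ x) → (∀ x, 0 < θ₀ x) →
    ∃ σ₀ : ℝ, 0 < σ₀ ∧ ∀ σ : ℝ, 0 < σ → σ < σ₀ →
      ∀ (T : ℝ) (ρ θ : ℝ → T3 → ℝ) (u : ℝ → T3 → V3), IsHardSphereEulerSolution σ T ρ u θ →
      ∀ Φ : (N : ℕ) → Flow σ N,
        TendstoHydroFieldsAt (fun N => localGibbsLaw σ a₀ u₀ θ₀ N (Φ N)) Φ ρ u θ 0 →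
        ∀ (t γ κ c CR E₁ e₀ : ℝ), 0 < t → t < T → 0 < γ → γ ≤ 1 / 15 → 0 < κ → κ ≤ 1 / 4 →
          0 < c → CR * σ ^ 3 ≤ 1 → 0 < e₀ →
          ∃ β : ℝ, 0 < β ∧
            Tendsto (fun N : ℕ => localGibbsLaw σ a₀ u₀ θ₀ N (Φ N)
              {z | ∃ τ ∈ Icc 0 t, (∀ s ∈ Icc 0 τ, ¬ RefChamberFails γ κ c CR E₁ e₀ N ((Φ N).flow s z)) ∧
                ((N : ℝ) + 1) ^ (-(3 * γ + β)) <
                  |matchedResidual σ (refKernel γ κ N) ρ θ u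
                    (fun s x => blockState (refKernel γ κ N) ((Φ N).flow s z) x) τ|})
              atTop (𝓝 0)

/-- THE WINDOW PACKAGE (conclusion of the stopped-window continuity argument): pre-shock, with LLN data, in
the dilute chamber `2ρ_clσ³ < η₁` (any `η₁ ≤ η₆`), at EVERY reference scale the reference block fields stay in
a chamber `{c ≤ ρ̄ ≤ C_R, Ē ≤ E₁, internal ≥ e₀}` with `C_Rσ³ ≤ η₁` on all of `[0, t]`, w.h.p. — two-sided
density bounds, the energy cap (the (i)-lines' hot-spot envelope `θ̄ ≤ ⅔E₁/c`) and a temperature floor, all as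
OUTPUTS. -/
def WindowPackage : Prop :=
  ∀ (a₀ θ₀ : T3 → ℝ) (u₀ : T3 → V3), Continuous a₀ → Continuous θ₀ → Continuous u₀ →
    (∀ x, 0 < a₀ x) → (∀ x, 0 < θ₀ x) →
    ∃ σ₀ : ℝ, 0 < σ₀ ∧ ∃ η₆ : ℝ, 0 < η₆ ∧ ∀ η₁ : ℝ, 0 < η₁ → η₁ ≤ η₆ →
      ∀ σ : ℝ, 0 < σ → σ < σ₀ →
      ∀ (T : ℝ) (ρ θ : ℝ → T3 → ℝ) (u : ℝ → T3 → V3), IsHardSphereEulerSolution σ T ρ u θ →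
      ∀ Φ : (N : ℕ) → Flow σ N,
        TendstoHydroFieldsAt (fun N => localGibbsLaw σ a₀ u₀ θ₀ N (Φ N)) Φ ρ u θ 0 →
        ∀ t : ℝ, 0 < t → t < T → (∀ s ∈ Icc 0 t, ∀ x, 2 * ρ s x * σ ^ 3 < η₁) →
          ∀ γ κ : ℝ, 0 < γ → γ ≤ 1 / 15 → 0 < κ → κ ≤ 1 / 4 →
            ∃ c CR E₁ e₀ : ℝ, 0 < c ∧ CR * σ ^ 3 ≤ η₁ ∧ 0 < E₁ ∧ 0 < e₀ ∧
              WindowFailureVanishes σ (fun N => localGibbsLaw σ a₀ u₀ θ₀ N (Φ N)) Φ t γ κ c CR E₁ e₀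

/-- PART (i) GIVEN THE WINDOW (the docking stub with the sibling line `visit-ledger-upscattering`, which
PRODUCES the time-averaged one-particle exponential moment from collision-entry statistics once block
temperatures are capped — the cap is this line's output; triage r1-2 G3, r1-3 C3: one stopping time for
both halves).  For small `σ`, every flow family and `t > 0`: if at SOME reference scale a chamber with
density floor `c > 0` and energy cap `E₁` covers `[0, t]` w.h.p., then part (i) holds at `(σ, Φ, t)`. -/
def PartOneOfWindow : Prop :=
  ∀ (a₀ θ₀ : T3 → ℝ) (u₀ : T3 → V3), Continuous a₀ → Continuous θ₀ → Continuous u₀ →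
    (∀ x, 0 < a₀ x) → (∀ x, 0 < θ₀ x) →
    ∃ σ₀ : ℝ, 0 < σ₀ ∧ ∀ σ : ℝ, 0 < σ → σ < σ₀ →
      ∀ (Φ : (N : ℕ) → Flow σ N) (t : ℝ), 0 < t →
        (∃ γ κ c CR E₁ e₀ : ℝ, 0 < γ ∧ γ ≤ 1 / 15 ∧ 0 < κ ∧ κ ≤ 1 / 4 ∧ 0 < c ∧ 0 < E₁ ∧
          WindowFailureVanishes σ (fun N => localGibbsLaw σ a₀ u₀ θ₀ N (Φ N)) Φ t γ κ c CR E₁ e₀) →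
        PartI σ a₀ θ₀ u₀ Φ t

/-- THE REPAIRED CRUX this line concludes: Disproof §6 `AprioriBoundsRepaired` (C′ — the crux conditioned,
exactly like the conjunct `HydrodynamicLimitFor`, on a classical hs-Euler solution on `[0, T)` with matching
LLN data, `0 < t < T`) PLUS the dilute-chamber clause of triage r1-3 C1 (`2ρ_clσ³ < η₁` on `[0, t]`, with
`η₁` existential right after `σ₀`, the shape in which the Assembly consumes chambers: DiluteSelfConsistency
3091 discharges it).  Components (i), (ii) VERBATIM. -/
def AprioriBoundsRepairedDilute : Prop :=
  ∀ (a₀ θ₀ : T3 → ℝ) (u₀ : T3 → V3), Continuous a₀ → Continuous θ₀ → Continuous u₀ →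
    (∀ x, 0 < a₀ x) → (∀ x, 0 < θ₀ x) →
    ∃ σ₀ : ℝ, 0 < σ₀ ∧ ∃ η₁ : ℝ, 0 < η₁ ∧ ∀ σ : ℝ, 0 < σ → σ < σ₀ →
      ∀ (T : ℝ) (ρ θ : ℝ → T3 → ℝ) (u : ℝ → T3 → V3), IsHardSphereEulerSolution σ T ρ u θ →
      ∀ Φ : (N : ℕ) → Flow σ N,
        TendstoHydroFieldsAt (fun N => localGibbsLaw σ a₀ u₀ θ₀ N (Φ N)) Φ ρ u θ 0 →
        ∀ t : ℝ, 0 < t → t < T → (∀ s ∈ Icc 0 t, ∀ x, 2 * ρ s x * σ ^ 3 < η₁) →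
          PartI σ a₀ θ₀ u₀ Φ t ∧ PartII σ a₀ θ₀ u₀ Φ t

/-- The typed crux from the repaired crux — the statement of the declared hole `stub_typedCrux_of_repaired`
(kept behind a name so that exactly one theorem of this file, `AprioriBounds_of`, concludes the route decl). -/
abbrev TypedCruxOfRepaired : Prop :=
  AprioriBoundsRepairedDilute →
    Summit.AtomisticToContinuum.HydrodynamicLimit.Theses.CollisionIsometryCLT.AprioriBounds

/-! ## Registered stubs -/

/-- STUB 1 (M + M, provable now; deterministic kernel/packing geometry at fixed `N`) — the footprint lemma
and the kernel sandwich.  Leans on: `Torus.kernel` API (`kernel_nonneg`, `integral_kernel`,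
`kernel_eq_zero_of_le`, `norm_gradient_kernel`; the profile equals its maximum on the inner ball of radius
`r/2`), `empiricalMeasure_eq` (finite sums), mean-value inequality on the torus lift, `measure_mono`. -/
theorem stub_kernelGeometry : FootprintLemma ∧ KernelSandwichLemma := by
  sorry

/-- STUB 2 (L; deterministic) — the matched relative-entropy Gronwall inequality, uniform in the kernel
radius.  Leans on: Dafermos2005 Thm 5.2.1 / (5.2.14) (relative entropy identity), the tree's weak–strong
layer `Literature.Analysis.PDE.ConservationLaw.dafermos_weak_strong_uniqueness_holds` (pattern), Jensen-gap
expansion `η(ψ⋆U) − ψ⋆η(U) = −½m₂Σ_kD²η[∂_kU,∂_kU] + O(r⁴)` for the even reference kernel, entropy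
conservation of classical solutions (`IsHardSphereEulerSolution`), Grönwall (`Mathlib`'s
`norm_le_gronwallBound_of_norm_deriv_right_le` pattern / integral form). -/
theorem stub_matchedGronwall : MatchedGronwallLemma := by
  sorry

/-- STUB 3 (L; probabilistic statics + Liouville) — the static budget at rate `(N+1)^{-3γ-β}`.  Leans on:
low-density cluster expansion for local Gibbs block fields (MesoscopicLLN 9524 / `localGibbs_lln` territory,
Ruelle1969, LebowitzPenrose1964) at CLT precision; invariance of the homogeneous Gibbs law
(GibbsInvariance 9239 / Disproof §4b `measurePreserving_regFlow_localGibbsMeasure`), Hölder transfer with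
`p − 1 ≍ (N+1)^{-3γ-β}` (SecondLawInProbability 9521's intended proof, sharpened to the deconvolved
functional, triage r1-1/r1-2 §A). -/
theorem stub_staticBudget : StaticBudgetLemma := by
  sorry

/-- STUB 4 (XL; HARDEST; probabilistic dynamics) — the matched weak residual at rate `(N+1)^{-3γ-β}` on the
window.  Content: RECENTRED kinetic closure `∫₀^τ∫∇Λ̃:(D − ½m₂h²ρ̄(∇ũ∇ũᵀ)°, q − q_res) = o(h³)` (the tested,
rated form of FastMomentRelaxation 9522 / StiffCollisionalRelaxation's foreseen `D♮`) and tested collisional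
transfer locality with rate (CollisionalTransferLocality 9518), both only while the reference chamber holds
(density in `[c, C_R]`, `C_Rσ³ ≤ 1`, energy `≤ E₁`, internal `≥ e₀`: bounded block temperatures, no vacuum,
no jam).  Why it might fail: a kinetic relaxation of the tested statistics slower than `N^{-3γ}` at the
Assembly's `γ` (then a smaller admissible `γ` must be used), or coherent sub-mesoscopic sound modes feeding
`h²ρ̄∇e∇e` into the recentred stress (card falsifier (a)/(b)). -/
theorem stub_matchedResidual : MatchedResidualLemma := by
  sorry

/-- STUB 5 (M/L; measure theory + two static facts) — THE STOPPED-WINDOW CONTINUITY ARGUMENT: footprint +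
matched Gronwall + static budget + matched residual ⇒ the window package.  Content: `τ_N :=` first time some
`x` has `‖Ū_N(s,x) − Ũ(s,x)‖ ≥ ε_*`, `ε_* := min(ε₀, chamber margins)` (chamber `c := ½ min ρ_cl`,
`C_R := η₁/σ³`, `E₁ := 2 max E_cl`, `e₀ := ¼ min (3/2)ρ_clθ_cl` over `[0,t] × 𝕋³`; `Ũ` sits in the inner
chamber by Jensen — internal energy is concave — so sup-closeness implies the reference chamber);
positions are continuous and block energies jump by `O(σ(N+1)^{-1/3}/r) → 0` at collisions, so at `τ_N`
the a-priori bounds of `FootprintLemma` hold and `‖Ū_N − Ũ‖(τ_N, x₀) ≥ ε_*`; on `[0, τ_N ∧ t]` the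
hypotheses of `MatchedGronwallLemma` hold for `U = Ū_N` with `δ₀, δ₂, δ_w ≤ (N+1)^{-3γ-β}`
outside an event of vanishing probability (the three rated inputs; the LLN profile `ρ₀` of
`StaticBudgetLemma` IS `ρ(0,·)` by uniqueness of limits in probability — `localGibbsLaw` is a probability
measure for `σ ≤ 1/2` or the zero measure, when everything is trivial); `K·4(N+1)^{-3γ-β} + K r_N⁴ < κ₀ r_N³`
eventually (`r_N = κ(N+1)^{-γ}`) contradicts the footprint, so `{τ_N ≤ t} ⊆` the bad events.  The
`EosStatics` clause of `StaticBudgetLemma` (threshold `η₆ ≤ η₀`, modulus `m`) discharges the first two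
hypotheses of `MatchedGronwallLemma`; smoothness/measurability of block fields (`IsSmooth.comp_sub_left`,
`aestronglyMeasurable` of flows); `localGibbsLaw` is a probability measure for `σ ≤ 1/2`
(`isProbabilityMeasure_localGibbsLaw`). -/
theorem stub_stoppedWindow :
    FootprintLemma → MatchedGronwallLemma → StaticBudgetLemma → MatchedResidualLemma → WindowPackage := by
  sorry

/-- STUB 6 (XL, the sibling line's deliverable; docking stub) — part (i) from the window.  Produced by
`visit-ledger-upscattering` (visit ledger B2 + initial moments B1 + entry statistics (U), (R) below the cap
`θ⁺ := ⅔E₁/c`, `λ < 1/(2θ⁺)` — Disproof §4d honoured there); stated here in the exact currency this line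
OUTPUTS (`WindowFailureVanishes`), so the two skeletons compose with one stopping time. -/
theorem stub_partOne_of_window : PartOneOfWindow := by
  sorry

/-- STUB 7 — THE DECLARED HOLE (triage r1-3 C0; r1-2 G1; Disproof §5 SUBSTANTIVE THREAT / §6 REPAIR).  The crux
AS TYPED (`∀ t > 0`, all continuous profiles, no classical solution, no chamber) from the repaired crux.  NOT
produced by this line or by any card on the board; suspect-false for focusing profiles past collapse
(Guderley reflected phase: vacuum and unbounded temperature at the centre) and void for profiles without a
classical development; unlandable either way with present tools.  It is here ONLY so that the skeleton
concludes the route decl by name while 9519 awaits the planner-level restatement to C′ (+ chamber clause);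
its converse `repairedDilute_of_typed` is proved below, so the stub is exactly the typed over-reach.  When
9519 is restated, delete this stub: `repairedDilute_of_statements` is the line. -/
theorem stub_typedCrux_of_repaired : TypedCruxOfRepaired := by
  sorry

/-! ## Proved glue -/

/-- SANITY (pure logic): the crux as typed implies the repaired crux — the repair is a weakening, so
`stub_typedCrux_of_repaired` asks for nothing beyond the typed statement itself, and every consumer of the
repaired form is served by the typed one. -/
theorem repairedDilute_of_typed
    (h : Summit.AtomisticToContinuum.HydrodynamicLimit.Theses.CollisionIsometryCLT.AprioriBounds) :
    AprioriBoundsRepairedDilute := by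
  intro a₀ θ₀ u₀ ha hθ hu ha0 hθ0
  obtain ⟨σ₀, hσ₀, H⟩ := h a₀ θ₀ u₀ ha hθ hu ha0 hθ0
  refine ⟨σ₀, hσ₀, 1, one_pos, ?_⟩
  intro σ hσ hσ' T ρ θ u _ Φ _ t ht _ _
  exact H σ hσ hσ' Φ t ht

/-- COMPOSITION (kernel-checked, no sorry; STATEMENT level): the six genuine stub STATEMENTS imply the
repaired crux `AprioriBoundsRepairedDilute`.  `σ₀ := min σ₆ σ₇` (window package, part (i) docking),
`η₁ := min η₆ A` (convexity threshold of the window package, sandwich constant); part (ii) for an arbitrary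
admissible family is the sandwich applied to the window package at all reference scales (`C_Rσ³ ≤ η₁ ≤ A`);
part (i) is the docking stub applied to the window package at the reference scale `γ = 1/15`, `κ = 1/4`. -/
theorem repairedDilute_of_statements
    (h₁ : FootprintLemma ∧ KernelSandwichLemma) (h₂ : MatchedGronwallLemma) (h₃ : StaticBudgetLemma)
    (h₄ : MatchedResidualLemma)
    (h₅ : FootprintLemma → MatchedGronwallLemma → StaticBudgetLemma → MatchedResidualLemma → WindowPackage)
    (h₆ : PartOneOfWindow) : AprioriBoundsRepairedDilute := by
  intro a₀ θ₀ u₀ ha hθ hu ha0 hθ0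
  obtain ⟨σ₆, hσ₆, η₆, hη₆, H6⟩ := h₅ h₁.1 h₂ h₃ h₄ a₀ θ₀ u₀ ha hθ hu ha0 hθ0
  obtain ⟨A, hA, H2⟩ := h₁.2
  obtain ⟨σ₇, hσ₇, H7⟩ := h₆ a₀ θ₀ u₀ ha hθ hu ha0 hθ0
  refine ⟨min σ₆ σ₇, lt_min hσ₆ hσ₇, min η₆ A, lt_min hη₆ hA, ?_⟩
  intro σ hσ hσlt T ρ θ u hsol Φ hlln t ht htT hcham
  have hσ6 : σ < σ₆ := lt_of_lt_of_le hσlt (min_le_left _ _)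
  have hσ7 : σ < σ₇ := lt_of_lt_of_le hσlt (min_le_right _ _)
  have H6' := H6 (min η₆ A) (lt_min hη₆ hA) (min_le_left _ _) σ hσ hσ6 T ρ θ u hsol Φ hlln t ht htT hcham
  refine ⟨?_, ?_⟩
  · obtain ⟨c, CR, E₁, e₀, hc, _, hE₁, _, hW⟩ :=
      H6' (1 / 15) (1 / 4) (by norm_num) le_rfl (by norm_num) le_rfl
    exact H7 σ hσ hσ7 Φ t ht
      ⟨1 / 15, 1 / 4, c, CR, E₁, e₀, by norm_num, le_rfl, by norm_num, le_rfl, hc, hE₁, hW⟩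
  · refine H2 σ hσ (fun N => localGibbsLaw σ a₀ u₀ θ₀ N (Φ N)) Φ t ?_
    intro γ κ hγ hγ' hκ hκ'
    obtain ⟨c, CR, E₁, e₀, hc, hCR, _, _, hW⟩ := H6' γ κ hγ hγ' hκ hκ'
    exact ⟨c, CR, E₁, e₀, hc, hCR.trans (min_le_right _ _), hW⟩

/-- THE SKELETON THEOREM (audit shape A12: concludes the crux decl BY NAME, no hypotheses; `sorry` lives only
in the seven registered stubs it invokes).  Six genuine stubs ⇒ the repaired crux (proved composition), then
the declared hole `stub_typedCrux_of_repaired`. -/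
theorem AprioriBounds_of :
    Summit.AtomisticToContinuum.HydrodynamicLimit.Theses.CollisionIsometryCLT.AprioriBounds :=
  stub_typedCrux_of_repaired
    (repairedDilute_of_statements stub_kernelGeometry stub_matchedGronwall stub_staticBudget
      stub_matchedResidual stub_stoppedWindow stub_partOne_of_window)

/-- The SAME skeleton for the other route wanting this shared crux (stmt-9519 is wanted verbatim by
StiffCollisionalRelaxation, whose copy of the decl the ledger lists first): the two route decls have identical
bodies, so the CollisionIsometryCLT skeleton closes the StiffCollisionalRelaxation decl by definitional unfolding. -/
theorem AprioriBounds_of_stiff :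
    Summit.AtomisticToContinuum.HydrodynamicLimit.Theses.StiffCollisionalRelaxation.AprioriBounds :=
  AprioriBounds_of

end Summit.AtomisticToContinuum.HydrodynamicLimit.Cruxes.AprioriBounds.CommutatorMatchedBootstrap

end
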